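import Literature.AlgebraicGeometry.Pohlmann1968.NondegenerateCMTypeFamilies
import Summits.HodgeConjecture.CorCM.CMBalancedWeightSplitting
import HarnessLib

/-!
# Pohlmann sets of a two-member family of CM types which every automorphism preserves or complements

COR-CM (cell `pub-hodgecm2`), seat b24, count-neutral lane QUARTIC-SLICE, part IVa (input of
`CorCM/QuarticCMTypeSliceBiquadratic.lean`; independent of the quartic files).  Everything is PROVED; theorems only; no
definition; no named fact.

SETTING.  `K` any CM field, `F : Fin 2 → CMType K` such that every `τ ∈ Aut(ℂ)` PRESERVES OR COMPLEMENTS each `F i`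
(`τ F i ∈ {F i, \overline{F i}}` — e.g. `F i` induced from an imaginary quadratic subfield), and some `τ₀` preserves `F 0`
while complementing `F 1`; products `⨁_{j<N} A_{F (π j)}` of realisations `A i` of `F i` (`π : Fin N → Fin 2`).  In the
bookkeeping of `Pohlmann1968.IsNondegenerateFamily` such a family is DEGENERATE (its types are not primitive), yet:

* `pair_mem_pohlmannSetsAlg_one` — an in-type and an out-of-type member of two slots of the same class form a balanced
  pair (the index of a divisor class);
* `card_filter_mem_eq_card_filter_not_mem` — class by class, a balanced weight has as many in-type as out-of-type
  members (balance at `1` and at `τ₀`: `a₀ + a₁ = b₀ + b₁`, `a₀ + b₁ = b₀ + a₁`);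
* **`pohlmannSetsAlg_subset_pohlmannDivisorSetsAlg_of_dichotomy`** — every Pohlmann set of `j ↦ F (π j)` is a disjoint
  union of balanced pairs (remove one pair — `CMWeights.isGaloisBalancedAlg_of_union_left` — and induct);
* **`hodgeClassSpan_prod_eq_divisorClassesSpan_of_dichotomy`** — `Bᵐ(⨁_j A_{F(π j)}) ⊗ ℂ = Dᵐ ⊗ ℂ`
  (`Pohlmann1968_thm1_cmAlgebra`, `divisorClassesSpan_biproduct_eq_iSup`), and
  **`hodgeConjectureFor_prod_of_dichotomy`** — the Hodge conjecture for every `⨁_j A_{F(π j)}`, UNCONDITIONALLY (Lefschetz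
  `(1,1)`): Imai's «`Hdg = Div` on `E₁^{n₁} × E₂^{n₂}`» (Gordon §3) in Pohlmann's coordinates, without Mumford–Tate groups.

## References
* [Gordon1999HodgeAVSurvey] B. B. Gordon, *A survey of the Hodge conjecture for abelian varieties*, §3 Theorem (Imai,
  Murty), §9.2 (9.2.1), 9.2.2, 10.10.
-/

noncomputable section

open CategoryTheory CategoryTheory.Limits NumberField NumberField.ComplexEmbedding
open Literature.AlgebraicGeometry Literature.AlgebraicGeometry.Motives Literature.AlgebraicGeometry.HodgeTheory
open Literature.AlgebraicGeometry.ComplexMultiplication (IsCMTypeRealisation)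
open Literature.AlgebraicGeometry.Pohlmann1968
open Literature.AlgebraicGeometry.VanGeemen1994 (hodgeClassSpan)
open Literature.Barriers.HodgeConjecture (divisorClassesSpan)
open Literature.NumberTheory.ComplexMultiplication
open Summit.HodgeConjecture.CorCM.CMWeights (isGaloisBalancedAlg_of_union_left)

namespace Summit.HodgeConjecture.CorCM.QuarticCM

variable {K : Type} [Field K] [NumberField K] [IsCMField K]

/-! ## §1 Pohlmann sets of a two-member family whose types every automorphism preserves or complements -/

section Pairing

variable (F : Fin 2 → CMType K) {N : ℕ} (π : Fin N → Fin 2)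

omit [NumberField K] [IsCMField K] in
/-- Counting a separated subset of a `Finset` as the cardinality of a filter. [folklore] -/
theorem ncard_sep_eq_card_filter {α : Type*} (S : Finset α) (p : α → Prop) [DecidablePred p] :
    {x | x ∈ S ∧ p x}.ncard = (S.filter p).card := by
  rw [← Set.ncard_coe_finset, Finset.coe_filter]

open scoped Classical in
omit [NumberField K] [IsCMField K] in
/-- **A balanced pair inside one class**: if every automorphism of `ℂ` preserves or complements the type `F i`, then for
`x, y` in slots of type `F i` with `x.2 ∈ F i`, `y.2 ∉ F i` the pair `{x, y}` satisfies Pohlmann's Galois condition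
(for every `τ` exactly one of `τ ∘ x.2`, `τ ∘ y.2` lies in `F i`) — the index of a divisor class.
[cite: Gordon1999HodgeAVSurvey, §9.2 (9.2.1) and 9.2.2] -/
theorem pair_mem_pohlmannSetsAlg_one
    (hW : ∀ (i : Fin 2) (τ : ℂ ≃+* ℂ), (∀ s : K →+* ℂ, τ • s ∈ (F i).1 ↔ s ∈ (F i).1) ∨
      (∀ s : K →+* ℂ, τ • s ∈ (F i).1 ↔ s ∉ (F i).1))
    {i : Fin 2} {x y : (_ : Fin N) × (K →+* ℂ)} (hx1 : π x.1 = i) (hy1 : π y.1 = i) (hx : x.2 ∈ (F i).1)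
    (hy : y.2 ∉ (F i).1) :
    ({x, y} : Finset ((_ : Fin N) × (K →+* ℂ))) ∈ pohlmannSetsAlg (K := fun _ : Fin N => K) (fun j => F (π j)) 1 := by
  have hne : x ≠ y := fun h => hy (by rw [← hy1, ← h, hx1]; exact hx)
  refine ⟨by rw [Finset.card_pair hne], fun τ => ?_⟩
  rw [ncard_sep_eq_card_filter, ncard_sep_eq_card_filter]
  change (Finset.filter (fun z : (_ : Fin N) × (K →+* ℂ) => τ • z.2 ∈ (F (π z.1)).1) {x, y}).card =
    (Finset.filter (fun z : (_ : Fin N) × (K →+* ℂ) => τ • z.2 ∉ (F (π z.1)).1) {x, y}).card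
  -- in either case one of the two filters is `{x}` and the other `{y}`
  have key : ∀ (p : (_ : Fin N) × (K →+* ℂ) → Prop) [DecidablePred p], (p x ↔ ¬p y) →
      (Finset.filter p {x, y}).card = (Finset.filter (fun z => ¬p z) {x, y}).card := by
    intro p _ hp
    by_cases hpx : p x
    · have hpy : ¬p y := hp.1 hpx
      rw [Finset.filter_insert, if_pos hpx, Finset.filter_singleton, if_neg hpy, Finset.filter_insert, if_neg (not_not.2 hpx),
        Finset.filter_singleton, if_pos hpy, Finset.card_singleton, Finset.card_insert_of_notMem (by simp), Finset.card_empty]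
    · have hpy : p y := not_not.1 fun h => hpx (hp.2 h)
      rw [Finset.filter_insert, if_neg hpx, Finset.filter_singleton, if_pos hpy, Finset.filter_insert, if_pos hpx,
        Finset.filter_singleton, if_neg (not_not.2 hpy), Finset.card_singleton, Finset.card_insert_of_notMem (by simp),
        Finset.card_empty]
  refine key _ ?_
  rw [hx1, hy1]
  rcases hW i τ with hP | hC
  · rw [hP, hP]; exact iff_of_true hx hy
  · rw [hC, hC, not_not]; exact iff_of_false (not_not.2 hx) hy

open scoped Classical in
omit [NumberField K] [IsCMField K] in
/-- **Class-by-class balance.**  If `S` satisfies Pohlmann's condition for the slots `j ↦ F (π j)` and `τ₀ ∈ Aut(ℂ)`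
preserves `F 0` and complements `F 1`, then inside EACH class the members of `S` lying in their slot's type are as
many as those outside it (balance at `1` and at `τ₀`: `a₀ + a₁ = b₀ + b₁`, `a₀ + b₁ = b₀ + a₁`).
[cite: Gordon1999HodgeAVSurvey, §9.2 (9.2.1)] -/
theorem card_filter_mem_eq_card_filter_not_mem {τ₀ : ℂ ≃+* ℂ} (h0 : ∀ s : K →+* ℂ, τ₀ • s ∈ (F 0).1 ↔ s ∈ (F 0).1)
    (h1 : ∀ s : K →+* ℂ, τ₀ • s ∈ (F 1).1 ↔ s ∉ (F 1).1) {S : Finset ((_ : Fin N) × (K →+* ℂ))}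
    (hS : IsGaloisBalancedAlg (K := fun _ : Fin N => K) (fun j => F (π j)) S) (i : Fin 2) :
    (S.filter fun z : (_ : Fin N) × (K →+* ℂ) => π z.1 = i ∧ z.2 ∈ (F i).1).card =
      (S.filter fun z : (_ : Fin N) × (K →+* ℂ) => π z.1 = i ∧ z.2 ∉ (F i).1).card := by
  have hfin : ∀ t : Fin 2, ¬t = 0 ↔ t = 1 := by decide
  -- splitting a filter along the two classes
  have hsplit : ∀ (p : (_ : Fin N) × (K →+* ℂ) → Prop) [DecidablePred p],
      (S.filter p).card = (S.filter fun z => π z.1 = 0 ∧ p z).card + (S.filter fun z => π z.1 = 1 ∧ p z).card := by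
    intro p _
    have h := Finset.card_filter_add_card_filter_not (s := S.filter p) (fun z : (_ : Fin N) × (K →+* ℂ) => π z.1 = 0)
    rw [Finset.filter_filter, Finset.filter_filter] at h
    have e0 : (S.filter fun z : (_ : Fin N) × (K →+* ℂ) => p z ∧ π z.1 = 0) =
        S.filter fun z => π z.1 = 0 ∧ p z := Finset.filter_congr fun z _ => and_comm
    have e1 : (S.filter fun z : (_ : Fin N) × (K →+* ℂ) => p z ∧ ¬π z.1 = 0) =
        S.filter fun z => π z.1 = 1 ∧ p z := Finset.filter_congr fun z _ => by rw [hfin]; exact and_comm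
    rw [e0, e1] at h
    exact h.symm
  -- the counting identities at `1` and `τ₀`
  have hS' : ∀ τ : ℂ ≃+* ℂ, (S.filter fun z : (_ : Fin N) × (K →+* ℂ) => τ • z.2 ∈ (F (π z.1)).1).card =
      (S.filter fun z : (_ : Fin N) × (K →+* ℂ) => τ • z.2 ∉ (F (π z.1)).1).card := fun τ => by
    have h := hS τ
    rwa [ncard_sep_eq_card_filter, ncard_sep_eq_card_filter] at h
  have e1 := hS' 1
  have e2 := hS' τ₀
  rw [hsplit, hsplit (fun z : (_ : Fin N) × (K →+* ℂ) => (1 : ℂ ≃+* ℂ) • z.2 ∉ (F (π z.1)).1)] at e1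
  rw [hsplit, hsplit (fun z : (_ : Fin N) × (K →+* ℂ) => τ₀ • z.2 ∉ (F (π z.1)).1)] at e2
  -- identify the eight filters with the four counts
  have r : ∀ (t : Fin 2) (q : (K →+* ℂ) → Prop) (q' : (K →+* ℂ) → Prop), (∀ s, q s ↔ q' s) →
      (S.filter fun z : (_ : Fin N) × (K →+* ℂ) => π z.1 = t ∧ q z.2).card =
        (S.filter fun z : (_ : Fin N) × (K →+* ℂ) => π z.1 = t ∧ q' z.2).card := fun t q q' hq =>
    congrArg Finset.card (Finset.filter_congr fun z _ => by rw [hq])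
  have c1 : ∀ t : Fin 2, (S.filter fun z : (_ : Fin N) × (K →+* ℂ) => π z.1 = t ∧ (1 : ℂ ≃+* ℂ) • z.2 ∈ (F (π z.1)).1).card =
      (S.filter fun z : (_ : Fin N) × (K →+* ℂ) => π z.1 = t ∧ z.2 ∈ (F t).1).card := fun t =>
    congrArg Finset.card (Finset.filter_congr fun z _ => by
      constructor
      · rintro ⟨ht, hz⟩; rw [one_smul, ht] at hz; exact ⟨ht, hz⟩
      · rintro ⟨ht, hz⟩; rw [one_smul, ht]; exact ⟨rfl, hz⟩)
  have c1' : ∀ t : Fin 2, (S.filter fun z : (_ : Fin N) × (K →+* ℂ) => π z.1 = t ∧ (1 : ℂ ≃+* ℂ) • z.2 ∉ (F (π z.1)).1).card =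
      (S.filter fun z : (_ : Fin N) × (K →+* ℂ) => π z.1 = t ∧ z.2 ∉ (F t).1).card := fun t =>
    congrArg Finset.card (Finset.filter_congr fun z _ => by
      constructor
      · rintro ⟨ht, hz⟩; rw [one_smul, ht] at hz; exact ⟨ht, hz⟩
      · rintro ⟨ht, hz⟩; rw [one_smul, ht]; exact ⟨rfl, hz⟩)
  have c2 : (S.filter fun z : (_ : Fin N) × (K →+* ℂ) => π z.1 = 0 ∧ τ₀ • z.2 ∈ (F (π z.1)).1).card =
      (S.filter fun z : (_ : Fin N) × (K →+* ℂ) => π z.1 = 0 ∧ z.2 ∈ (F 0).1).card :=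
    congrArg Finset.card (Finset.filter_congr fun z _ => by
      constructor
      · rintro ⟨ht, hz⟩; rw [ht, h0] at hz; exact ⟨ht, hz⟩
      · rintro ⟨ht, hz⟩; rw [ht, h0]; exact ⟨rfl, hz⟩)
  have c2' : (S.filter fun z : (_ : Fin N) × (K →+* ℂ) => π z.1 = 0 ∧ τ₀ • z.2 ∉ (F (π z.1)).1).card =
      (S.filter fun z : (_ : Fin N) × (K →+* ℂ) => π z.1 = 0 ∧ z.2 ∉ (F 0).1).card :=
    congrArg Finset.card (Finset.filter_congr fun z _ => by
      constructor
      · rintro ⟨ht, hz⟩; rw [ht, h0] at hz; exact ⟨ht, hz⟩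
      · rintro ⟨ht, hz⟩; rw [ht, h0]; exact ⟨rfl, hz⟩)
  have c3 : (S.filter fun z : (_ : Fin N) × (K →+* ℂ) => π z.1 = 1 ∧ τ₀ • z.2 ∈ (F (π z.1)).1).card =
      (S.filter fun z : (_ : Fin N) × (K →+* ℂ) => π z.1 = 1 ∧ z.2 ∉ (F 1).1).card :=
    congrArg Finset.card (Finset.filter_congr fun z _ => by
      constructor
      · rintro ⟨ht, hz⟩; rw [ht, h1] at hz; exact ⟨ht, hz⟩
      · rintro ⟨ht, hz⟩; rw [ht, h1]; exact ⟨rfl, hz⟩)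
  have c3' : (S.filter fun z : (_ : Fin N) × (K →+* ℂ) => π z.1 = 1 ∧ τ₀ • z.2 ∉ (F (π z.1)).1).card =
      (S.filter fun z : (_ : Fin N) × (K →+* ℂ) => π z.1 = 1 ∧ z.2 ∈ (F 1).1).card :=
    congrArg Finset.card (Finset.filter_congr fun z _ => by
      constructor
      · rintro ⟨ht, hz⟩; rw [ht, h1, not_not] at hz; exact ⟨ht, hz⟩
      · rintro ⟨ht, hz⟩; rw [ht, h1, not_not]; exact ⟨rfl, hz⟩)
  rw [c1, c1, c1', c1'] at e1
  rw [c2, c2', c3, c3'] at e2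
  fin_cases i
  · change (S.filter fun z : (_ : Fin N) × (K →+* ℂ) => π z.1 = 0 ∧ z.2 ∈ (F 0).1).card =
      (S.filter fun z : (_ : Fin N) × (K →+* ℂ) => π z.1 = 0 ∧ z.2 ∉ (F 0).1).card
    omega
  · change (S.filter fun z : (_ : Fin N) × (K →+* ℂ) => π z.1 = 1 ∧ z.2 ∈ (F 1).1).card =
      (S.filter fun z : (_ : Fin N) × (K →+* ℂ) => π z.1 = 1 ∧ z.2 ∉ (F 1).1).card
    omega

open scoped Classical in
omit [NumberField K] [IsCMField K] in
/-- **Every Pohlmann set of such a family is a disjoint union of balanced pairs** (`pohlmannSetsAlg ⊆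
pohlmannDivisorSetsAlg`): a nonempty balanced weight contains, in the class of any of its members, an in-type and an
out-of-type member (class-by-class balance); they form a balanced pair, removing it leaves a balanced weight
(`CMWeights.isGaloisBalancedAlg_of_union_left`), induct.  So on every `⨁_j A_{F (π j)}` the Hodge ring is generated by
divisor classes. [cite: Gordon1999HodgeAVSurvey, §9.2 (9.2.1) and 9.2.2] -/
theorem pohlmannSetsAlg_subset_pohlmannDivisorSetsAlg_of_dichotomy
    (hW : ∀ (i : Fin 2) (τ : ℂ ≃+* ℂ), (∀ s : K →+* ℂ, τ • s ∈ (F i).1 ↔ s ∈ (F i).1) ∨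
      (∀ s : K →+* ℂ, τ • s ∈ (F i).1 ↔ s ∉ (F i).1))
    {τ₀ : ℂ ≃+* ℂ} (h0 : ∀ s : K →+* ℂ, τ₀ • s ∈ (F 0).1 ↔ s ∈ (F 0).1)
    (h1 : ∀ s : K →+* ℂ, τ₀ • s ∈ (F 1).1 ↔ s ∉ (F 1).1) :
    ∀ (m : ℕ) (S : Finset ((_ : Fin N) × (K →+* ℂ))),
      S ∈ pohlmannSetsAlg (K := fun _ : Fin N => K) (fun j => F (π j)) m →
        S ∈ pohlmannDivisorSetsAlg (K := fun _ : Fin N => K) (fun j => F (π j)) m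
  | 0, S, hS => by
    rw [pohlmannDivisorSetsAlg_def, mem_disjointUnionsOf_zero]
    exact Finset.card_eq_zero.1 (by rw [hS.1])
  | m + 1, S, hS => by
    obtain ⟨hcard, hbal⟩ := hS
    obtain ⟨x, hx⟩ : S.Nonempty := Finset.card_pos.1 (by rw [hcard]; omega)
    -- a partner of `x` in its class, on the other side of the type
    have hcnt := card_filter_mem_eq_card_filter_not_mem F π h0 h1 hbal (π x.1)
    obtain ⟨y, hyS, hy1, hxy⟩ : ∃ y ∈ S, π y.1 = π x.1 ∧ (x.2 ∈ (F (π x.1)).1 ↔ y.2 ∉ (F (π x.1)).1) := by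
      by_cases hxm : x.2 ∈ (F (π x.1)).1
      · have hpos : 0 < (S.filter fun z : (_ : Fin N) × (K →+* ℂ) => π z.1 = π x.1 ∧ z.2 ∉ (F (π x.1)).1).card := by
          rw [← hcnt]; exact Finset.card_pos.2 ⟨x, Finset.mem_filter.2 ⟨hx, rfl, hxm⟩⟩
        obtain ⟨y, hy⟩ := Finset.card_pos.1 hpos
        rw [Finset.mem_filter] at hy
        exact ⟨y, hy.1, hy.2.1, iff_of_true hxm hy.2.2⟩
      · have hpos : 0 < (S.filter fun z : (_ : Fin N) × (K →+* ℂ) => π z.1 = π x.1 ∧ z.2 ∈ (F (π x.1)).1).card := by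
          rw [hcnt]; exact Finset.card_pos.2 ⟨x, Finset.mem_filter.2 ⟨hx, rfl, hxm⟩⟩
        obtain ⟨y, hy⟩ := Finset.card_pos.1 hpos
        rw [Finset.mem_filter] at hy
        exact ⟨y, hy.1, hy.2.1, iff_of_false hxm (not_not.2 hy.2.2)⟩
    -- the pair `{x, y}` is balanced
    have hP : ({x, y} : Finset ((_ : Fin N) × (K →+* ℂ))) ∈
        pohlmannSetsAlg (K := fun _ : Fin N => K) (fun j => F (π j)) 1 := by
      by_cases hxm : x.2 ∈ (F (π x.1)).1
      · exact pair_mem_pohlmannSetsAlg_one F π hW rfl hy1 hxm (hxy.1 hxm)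
      · have hym : y.2 ∈ (F (π x.1)).1 := not_not.1 fun h => hxm (hxy.2 h)
        rw [Finset.pair_comm]
        exact pair_mem_pohlmannSetsAlg_one F π hW hy1 rfl hym hxm
    -- remove it and induct
    have hsub : ({x, y} : Finset ((_ : Fin N) × (K →+* ℂ))) ⊆ S := by
      intro z hz
      simp only [Finset.mem_insert, Finset.mem_singleton] at hz
      rcases hz with rfl | rfl
      exacts [hx, hyS]
    have hdisj : Disjoint ({x, y} : Finset ((_ : Fin N) × (K →+* ℂ))) (S \ {x, y}) := Finset.disjoint_sdiff
    have hST : S = {x, y} ∪ S \ {x, y} := (Finset.union_sdiff_of_subset hsub).symm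
    have hRbal : IsGaloisBalancedAlg (K := fun _ : Fin N => K) (fun j => F (π j)) (S \ {x, y}) :=
      isGaloisBalancedAlg_of_union_left (hST ▸ hbal) hP.2 hdisj
    have hRcard : (S \ {x, y}).card = 2 * m := by
      have h := Finset.card_union_of_disjoint hdisj
      rw [← hST, hcard, hP.1] at h
      omega
    have hRdiv := pohlmannSetsAlg_subset_pohlmannDivisorSetsAlg_of_dichotomy hW h0 h1 m (S \ {x, y}) ⟨hRcard, hRbal⟩
    rw [pohlmannDivisorSetsAlg_def, mem_disjointUnionsOf_succ]
    exact ⟨S \ {x, y}, hRdiv, {x, y}, hP, hdisj.symm, by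
      rw [Finset.disjUnion_eq_union, Finset.sdiff_union_of_subset hsub]⟩

variable {F} {A : Fin 2 → AbelianVariety ℂ} {ι : ∀ i, 𝓞 K →+* End (A i)}
  {θ : ∀ i, K →+* Module.End ℂ (complexBetti (A i).X 1)}

omit [IsCMField K] in
/-- **`Bᵐ(⨁_j A_{F(π j)}) ⊗ ℂ = Dᵐ ⊗ ℂ`** for realisations `A i` of such a family: Pohlmann's theorem for the CM algebra
`K^N` (`Pohlmann1968_thm1_cmAlgebra`), the divisor dictionary (`divisorClassesSpan_biproduct_eq_iSup`) and §1.
[cite: Gordon1999HodgeAVSurvey, §9.2 and 9.2.2] -/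
theorem hodgeClassSpan_prod_eq_divisorClassesSpan_of_dichotomy
    (hW : ∀ (i : Fin 2) (τ : ℂ ≃+* ℂ), (∀ s : K →+* ℂ, τ • s ∈ (F i).1 ↔ s ∈ (F i).1) ∨
      (∀ s : K →+* ℂ, τ • s ∈ (F i).1 ↔ s ∉ (F i).1))
    {τ₀ : ℂ ≃+* ℂ} (h0 : ∀ s : K →+* ℂ, τ₀ • s ∈ (F 0).1 ↔ s ∈ (F 0).1)
    (h1 : ∀ s : K →+* ℂ, τ₀ • s ∈ (F 1).1 ↔ s ∉ (F 1).1)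
    (hA : ∀ i, IsCMTypeRealisation (F i) (A i) (ι i) (θ i)) (m : ℕ) :
    hodgeClassSpan (⨁ fun j => A (π j)).dim (⨁ fun j => A (π j)).X m =
      divisorClassesSpan (⨁ fun j => A (π j)).X (⨁ fun j => A (π j)).dim m := by
  refine le_antisymm ?_ (divisorClassesSpan_biproduct_le_hodgeClassSpan (K := fun _ : Fin N => K)
    (A := fun j => A (π j)) (Φ := fun j => F (π j)) (ι := fun j => ι (π j)) (θ := fun j => θ (π j))
    (fun j => hA (π j)) m)
  rw [divisorClassesSpan_biproduct_eq_iSup (K := fun _ : Fin N => K) (A := fun j => A (π j)) (Φ := fun j => F (π j))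
      (ι := fun j => ι (π j)) (θ := fun j => θ (π j)) (fun j => hA (π j)) m,
    (Pohlmann1968_thm1_cmAlgebra (fun _ : Fin N => K) (fun j => A (π j)) (fun j => F (π j)) (fun j => ι (π j))
      (fun j => θ (π j)) (fun j => hA (π j)) m).1]
  exact iSup₂_le fun S hS => le_iSup₂_of_le S
    (pohlmannSetsAlg_subset_pohlmannDivisorSetsAlg_of_dichotomy F π hW h0 h1 m S hS) le_rfl

omit [IsCMField K] in
/-- **The Hodge conjecture for every product `⨁_j A_{F(π j)}`** of realisations of such a family, unconditionally
(every Hodge class is a polynomial in divisor classes; Lefschetz `(1,1)`, `lefschetzOneOne_rational_holds`).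
[cite: Gordon1999HodgeAVSurvey, §3 Theorem and 10.10] -/
theorem hodgeConjectureFor_prod_of_dichotomy
    (hW : ∀ (i : Fin 2) (τ : ℂ ≃+* ℂ), (∀ s : K →+* ℂ, τ • s ∈ (F i).1 ↔ s ∈ (F i).1) ∨
      (∀ s : K →+* ℂ, τ • s ∈ (F i).1 ↔ s ∉ (F i).1))
    {τ₀ : ℂ ≃+* ℂ} (h0 : ∀ s : K →+* ℂ, τ₀ • s ∈ (F 0).1 ↔ s ∈ (F 0).1)
    (h1 : ∀ s : K →+* ℂ, τ₀ • s ∈ (F 1).1 ↔ s ∉ (F 1).1)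
    (hA : ∀ i, IsCMTypeRealisation (F i) (A i) (ι i) (θ i)) :
    HodgeConjectureFor (⨁ fun j => A (π j)).dim (⨁ fun j => A (π j)).X := by
  refine ⟨nonempty_hodgeModel_holds (Motives.AbelianVariety.isSmoothProjective_holds (A := ⨁ fun j => A (π j))),
    fun m c hc hmm => ?_⟩
  refine AbelianVariety.divisorClassesSpan_le_algebraicClasses (⨁ fun j => A (π j))
    (fun b hb hb' => lefschetzOneOne_rational_holds
      (Motives.AbelianVariety.isSmoothProjective_holds (A := ⨁ fun j => A (π j))) b hb hb') m ?_
  rw [← hodgeClassSpan_prod_eq_divisorClassesSpan_of_dichotomy π hW h0 h1 hA m]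
  exact Submodule.subset_span ⟨hc, hmm⟩

end Pairing

end Summit.HodgeConjecture.CorCM.QuarticCM

end
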